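import Literature.Computability.AlgebraicComplexity.SubstitutionBacktracking
import HarnessLib

/-!
# Weighted (fractional) substitution: many substitution inequalities at once

Topic `Literature/Computability/AlgebraicComplexity`. Everything here is PROVED for an arbitrary
bilinear map `φ : U × V → W` over a field; no definitions of mathematical content, no named facts.
A companion of `SubstitutionBacktracking.lean` (Wang 2026, §6–§7), in the same vocabulary
(`BilinComp`, `constrSub K`, `constrSubF K c F`, a covering family of candidate forms `c n`, a sound
oracle `LB` on the sections `S_F`).

The substitution lemma (Wang 2026, Lemma 3; Pan 1966) says: imposing further constraint forms on the
first argument kills every product of a bilinear computation whose first form vanishes on the smaller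
subspace, and the surviving products compute the restricted map. For a fixed computation `β` of
`φ|_{S × V}` with first forms proportional to candidates `c_{n(i)}`, and ANY set `F` of candidates,
this gives the linear inequality

  `LB F ≤ #{i : c_{n(i)} does not vanish on S_F}`                                   (∗_F)

in the unknown "form counts" of `β`. The DFS of `SubstitutionBacktracking.lean` uses these one at a
time. This file proves the WEIGHTED form: for nonnegative integer weights `y_F` and a denominator
`D` with `∑_{F : c_n survives F} y_F ≤ D` for every candidate `n` ("dual feasibility"), summing
`y_F · (∗_F)` and exchanging the sums gives

  `∑_F y_F · LB F ≤ D · (number of products)`,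

hence every computation has at least `⌈(∑_F y_F · LB F) / D⌉` products
(`le_card_of_lpDual`: a target `t` is certified when `(t - 1)·D < ∑_F y_F·LB F`). This is the
linear-programming relaxation of the case analysis (minimise the number of products subject to all
inequalities `(∗_F)`), certified by an integer-scaled dual vector; no rational arithmetic and no LP
theory are needed in the kernel — only the exchange of two finite sums. With a single set `F`,
`y_F = D = 1`, it is the one-set rule behind `LeafOK`.

Which candidates a set `F` kills is supplied abstractly as a decidable predicate `kill F n` with the
soundness hypothesis `kill F n → c_n = 0 on S_F`; the instance `kill F n := (n ∈ F)` is always sound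
(`le_card_of_lpDual_mem`), and a checker may use the larger set of all candidates in the span of
`K ∪ c[F]`.

HONEST FRAMING: an elementary counting lemma (weighted sum of valid substitution inequalities),
written to serve as the soundness theorem of an "LP leaf" in certificate checkers of the
`GF2OrbitSweep` kind; it proves no bound on any particular tensor.

## References

* C. Wang, *Automated Lower Bounds for Bilinear Complexity over Finite Fields*, arXiv:2603.07280
  (2026), §6 (Lemma 3: substitution; substitution with backtracking), §7. [Wang2026]
* V. Ya. Pan, *Methods of computing values of polynomials*, Russian Math. Surveys 21 (1966)
  105–136 (the substitution method), as cited in Wang 2026 §6. [Wang2026]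
* M. Bläser, J. Complexity 19 (2003) 43–60, Def. 1 (bilinear computations). [Blaser2003]
-/

namespace Literature.Computability.AlgebraicComplexity

open Module

variable {k : Type*} [Field k]
variable {U V W : Type*} [AddCommGroup U] [Module k U] [AddCommGroup V] [Module k V]
  [AddCommGroup W] [Module k W]

section LPDual

variable {φ : U →ₗ[k] V →ₗ[k] W} {K : List (Dual k U)} {N : ℕ} {c : Fin N → Dual k U}
  {LB : Finset (Fin N) → ℕ}

/-- **One substitution inequality per set of candidates, for a fixed computation** (Wang 2026,
Lemma 3): if the first forms of `β` are unit multiples of candidates, `f_i = a_i · c_{n i}`, then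
for every set `F` the oracle value `LB F` is at most the number of products whose candidate is not
killed by `F` (the killed ones vanish on `S_F`, the others compute `φ|_{S_F × V}`).
[cite: Wang2026, Lemma 3 (substitution) and §7] -/
theorem lb_le_card_filter_not_kill
    (hLB : ∀ F r, BilinComp (φ.comp (constrSubF K c F).subtype) (Fin r) → LB F ≤ r)
    (kill : Finset (Fin N) → Fin N → Prop) [∀ F n, Decidable (kill F n)]
    (F : Finset (Fin N))
    (hkill : ∀ n, kill F n → ∀ u : U, u ∈ constrSubF K c F → c n u = 0)
    {r₀ : ℕ} (β : BilinComp (φ.comp (constrSub K).subtype) (Fin r₀))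
    (n : Fin r₀ → Fin N) (a : Fin r₀ → k) (hf : ∀ i (u : constrSub K), β.f i u = a i * c (n i) u) :
    LB F ≤ (Finset.univ.filter fun i => ¬ kill F (n i)).card := by
  classical
  let J : Finset (Fin r₀) := Finset.univ.filter fun i => kill F (n i)
  have hJ : ∀ i ∈ J, ∀ u : ↥(constrSubF K c F),
      β.f i (Submodule.inclusion (constrSubF_le K c F) u) = 0 := by
    intro i hi u
    have hki : kill F (n i) := (Finset.mem_filter.1 hi).2
    rw [hf]
    have hu : c (n i) (u : U) = 0 := hkill (n i) hki u u.2
    simp [Submodule.coe_inclusion, hu]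
  obtain ⟨β'⟩ := β.exists_restrictAlong (constrSubF_le K c F) J hJ
  have h1 := hLB F _ β'
  have h2 : J.card + (Finset.univ.filter fun i => ¬ kill F (n i)).card = r₀ := by
    have := Finset.card_filter_add_card_filter_not
      (s := (Finset.univ : Finset (Fin r₀))) (fun i => kill F (n i))
    simpa using this
  simp only [Fintype.card_fin] at h1
  omega

/-- **Weighted substitution (the LP dual bound).** Let `𝒰` be a family of candidate sets with
integer weights `y` and denominator `D` such that, for every candidate `n`, the total weight of the
sets NOT killing `n` is at most `D`. Then for every computation of `φ|_{S × V}`: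
`∑_{F ∈ 𝒰} y_F · LB F ≤ D · (number of products)`. Proof: shorten to nonzero first forms, name a
candidate for each product (`hcov`), apply `lb_le_card_filter_not_kill` to every `F`, multiply by
`y_F`, and exchange the two finite sums.
[cite: Wang2026, Lemma 3 (substitution) and §6–§7 (substitution with backtracking)] -/
theorem sum_mul_lb_le_mul_card
    (hLB : ∀ F r, BilinComp (φ.comp (constrSubF K c F).subtype) (Fin r) → LB F ≤ r)
    (hcov : ∀ f : Dual k (constrSub K), f ≠ 0 →
      ∃ n, ∃ a : k, a ≠ 0 ∧ ∀ u, f u = a * c n u)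
    (𝒰 : Finset (Finset (Fin N))) (y : Finset (Fin N) → ℕ) (D : ℕ)
    (kill : Finset (Fin N) → Fin N → Prop) [∀ F n, Decidable (kill F n)]
    (hkill : ∀ F ∈ 𝒰, ∀ n, kill F n → ∀ u : U, u ∈ constrSubF K c F → c n u = 0)
    (hdual : ∀ n : Fin N, ∑ F ∈ 𝒰.filter (fun F => ¬ kill F n), y F ≤ D)
    {ι : Type*} [Fintype ι] (β : BilinComp (φ.comp (constrSub K).subtype) ι) :
    ∑ F ∈ 𝒰, y F * LB F ≤ D * Fintype.card ι := by
  classical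
  -- shorten to nonzero first forms
  obtain ⟨r₀, hr₀, β₀, hnz⟩ := β.exists_forall_f_ne_zero
  refine le_trans ?_ (Nat.mul_le_mul_left D hr₀)
  -- a candidate and a unit for each product
  choose n a ha hfa using fun i => hcov (β₀.f i) (hnz i)
  -- each inequality (∗_F), weighted
  have hF : ∀ F ∈ 𝒰, y F * LB F ≤
      y F * (Finset.univ.filter fun i : Fin r₀ => ¬ kill F (n i)).card := fun F hF𝒰 =>
    Nat.mul_le_mul_left _
      (lb_le_card_filter_not_kill hLB kill F (hkill F hF𝒰) β₀ n a (fun i u => hfa i u))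
  refine (Finset.sum_le_sum hF).trans ?_
  -- rewrite `y_F · #survivors` as a double sum and exchange
  have hrw : ∀ F ∈ 𝒰, y F * (Finset.univ.filter fun i : Fin r₀ => ¬ kill F (n i)).card =
      ∑ i : Fin r₀, if ¬ kill F (n i) then y F else 0 := by
    intro F _
    rw [← Finset.sum_filter, Finset.sum_const, smul_eq_mul, Nat.mul_comm]
  rw [Finset.sum_congr rfl hrw, Finset.sum_comm]
  -- per product, dual feasibility at its candidate
  have hi : ∀ i : Fin r₀, (∑ F ∈ 𝒰, if ¬ kill F (n i) then y F else 0) ≤ D := by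
    intro i
    rw [← Finset.sum_filter]
    exact hdual (n i)
  calc ∑ i : Fin r₀, ∑ F ∈ 𝒰, (if ¬ kill F (n i) then y F else 0)
      ≤ ∑ _i : Fin r₀, D := Finset.sum_le_sum fun i _ => hi i
    _ = D * r₀ := by simp [Nat.mul_comm]

/-- **Certificate form**: under the hypotheses of `sum_mul_lb_le_mul_card`, a target `t` with
`(t - 1)·D < ∑_{F ∈ 𝒰} y_F · LB F` is a lower bound for every computation of `φ|_{S × V}`
(i.e. `t ≤ ⌈(∑ y_F LB F)/D⌉ ≤` number of products). This is the shape a certificate checker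
evaluates: finitely many sandwich/orbit lookups giving the `LB F`, the per-candidate inequalities
`hdual`, and one inequality in `ℕ`.
[cite: Wang2026, Lemma 3 (substitution) and §7 (certificates)] -/
theorem le_card_of_lpDual
    (hLB : ∀ F r, BilinComp (φ.comp (constrSubF K c F).subtype) (Fin r) → LB F ≤ r)
    (hcov : ∀ f : Dual k (constrSub K), f ≠ 0 →
      ∃ n, ∃ a : k, a ≠ 0 ∧ ∀ u, f u = a * c n u)
    (𝒰 : Finset (Finset (Fin N))) (y : Finset (Fin N) → ℕ) (D : ℕ)
    (kill : Finset (Fin N) → Fin N → Prop) [∀ F n, Decidable (kill F n)]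
    (hkill : ∀ F ∈ 𝒰, ∀ n, kill F n → ∀ u : U, u ∈ constrSubF K c F → c n u = 0)
    (hdual : ∀ n : Fin N, ∑ F ∈ 𝒰.filter (fun F => ¬ kill F n), y F ≤ D)
    {t : ℕ} (ht : (t - 1) * D < ∑ F ∈ 𝒰, y F * LB F)
    {ι : Type*} [Fintype ι] (β : BilinComp (φ.comp (constrSub K).subtype) ι) :
    t ≤ Fintype.card ι := by
  have h := sum_mul_lb_le_mul_card hLB hcov 𝒰 y D kill hkill hdual β
  have h' : D * (t - 1) < D * Fintype.card ι := by
    rw [Nat.mul_comm D (t - 1)]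
    exact ht.trans_le h
  have := Nat.lt_of_mul_lt_mul_left h'
  omega

/-- The always-available instance `kill F n := n ∈ F` (a candidate in `F` vanishes on `S_F` by
definition of `constrSubF`): dual feasibility reads `∑_{F ∈ 𝒰, n ∉ F} y_F ≤ D` for every
candidate `n`. [cite: Wang2026, Lemma 3 (substitution) and §7 (certificates)] -/
theorem le_card_of_lpDual_mem
    (hLB : ∀ F r, BilinComp (φ.comp (constrSubF K c F).subtype) (Fin r) → LB F ≤ r)
    (hcov : ∀ f : Dual k (constrSub K), f ≠ 0 →
      ∃ n, ∃ a : k, a ≠ 0 ∧ ∀ u, f u = a * c n u)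
    (𝒰 : Finset (Finset (Fin N))) (y : Finset (Fin N) → ℕ) (D : ℕ)
    (hdual : ∀ n : Fin N, ∑ F ∈ 𝒰.filter (fun F => n ∉ F), y F ≤ D)
    {t : ℕ} (ht : (t - 1) * D < ∑ F ∈ 𝒰, y F * LB F)
    {ι : Type*} [Fintype ι] (β : BilinComp (φ.comp (constrSub K).subtype) ι) :
    t ≤ Fintype.card ι :=
  le_card_of_lpDual hLB hcov 𝒰 y D (fun F n => n ∈ F)
    (fun _ _ n hn _ hu => (mem_constrSubF.1 hu).2 n hn) hdual ht β

/-- Sanity check: a single set `F` with weight `1` and `D = 1` recovers the one-set substitution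
bound `LB F ≤` number of products (the rule behind `LeafOK` at depth `0`).
[cite: Wang2026, Lemma 3 (substitution)] -/
theorem lb_le_card_of_cover
    (hLB : ∀ F r, BilinComp (φ.comp (constrSubF K c F).subtype) (Fin r) → LB F ≤ r)
    (hcov : ∀ f : Dual k (constrSub K), f ≠ 0 →
      ∃ n, ∃ a : k, a ≠ 0 ∧ ∀ u, f u = a * c n u)
    (F : Finset (Fin N)) {ι : Type*} [Fintype ι]
    (β : BilinComp (φ.comp (constrSub K).subtype) ι) :
    LB F ≤ Fintype.card ι := by
  classical
  have h := sum_mul_lb_le_mul_card hLB hcov {F} (fun _ => 1) 1 (fun F n => n ∈ F)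
    (fun _ _ n hn _ hu => (mem_constrSubF.1 hu).2 n hn)
    (fun n => by
      calc ∑ G ∈ ({F} : Finset (Finset (Fin N))).filter (fun G => n ∉ G), (1 : ℕ)
          ≤ ∑ _G ∈ ({F} : Finset (Finset (Fin N))), (1 : ℕ) :=
            Finset.sum_le_sum_of_subset (Finset.filter_subset _ _)
        _ = 1 := by simp) β
  simpa using h

end LPDual

end Literature.Computability.AlgebraicComplexity
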